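import Mathlib
import Summits.Ventures.DiscreteObjects.Mahler.SmythIsolationEquality

/-!
# Smyth's theorem: the extremal trinomials are irreducible; the equality case verbatim
(venture `DiscreteObjects`, target L)

Cell `pub-namedobj`, seat `pub-namedobj-mahler` (gen 9). Framing: lottery ticket; floor = certified
bounds/negative ranges.

[McKee–Smyth, *Around the Unit Circle*, Thm 12.1]: for monic irreducible nonreciprocal `P`, `M(P) = θ₀`
"precisely for the polynomials `z^{3n} - z^n - 1` and `z^{3n} + z^{2n} - 1` (`n ≥ 1`), as well as for
those with `z` replaced by `-z`".  `SmythIsolationEquality` gives this in divisibility form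
(`P ∣ P₀(aX^k)` or `P ∣ Q₀(aX^k)`, `P₀ = 1 - z² + z³`, `Q₀ = 1 - z + z³`, `a = ±1`).  Here we prove that
the trinomials `P₀(aX^k) = 1 - X^{2k} + aX^{3k}` and `Q₀(aX^k) = 1 - aX^k + aX^{3k}` are IRREDUCIBLE over
`ℤ` — by Smyth's inequality itself, in the spirit of [McKee–Smyth, Exercise 12.4]: a (anti)reciprocal
factor would have a root pair `β, β⁻¹`, impossible since `Q₀` (resp. `P₀`) has no root pair `y, y⁻¹`; so
every nonconstant factor is nonreciprocal of measure `≥ θ₀`, while the product has measure `θ₀ < θ₀²` —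
and deduce the equality case of Thm 12.1 as printed: `M(P) = θ₀ ↔ P = ±P₀(aX^k)` or `P = ±Q₀(aX^k)`
(the four sign families are `z^{3n} - z^n - 1`, `z^{3n} + z^{2n} - 1` and their `z ↦ -z` companions).

* `smythQ0_no_inverse_pair`, `smythP0_no_inverse_pair` — no root pairs `y, y⁻¹`;
* `natDegree_eq_zero_of_reciprocal_dvd` — a (anti)reciprocal factor of such a trinomial is constant;
* `irreducible_of_smyth_trinomial`, `irreducible_smythQ0a`, `irreducible_smythP0a` — irreducibility;
* `intMahlerMeasure_eq_smythTheta_iff_eq` — **the equality case of Thm 12.1, verbatim form**.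
-/

namespace Summit.Ventures.DiscreteObjects.Mahler

open Polynomial

/-! ### No root pairs `y, y⁻¹` -/

/-- `Q₀(y) = 1 - y + y³` and `Q₀(y⁻¹)` do not vanish simultaneously. -/
theorem smythQ0_no_inverse_pair {y : ℂ} (hy : y ≠ 0) (h1 : 1 - y + y ^ 3 = 0)
    (h2 : 1 - y⁻¹ + y⁻¹ ^ 3 = 0) : False := by
  have h2' : y ^ 3 - y ^ 2 + 1 = 0 := by
    have e : (1 - y⁻¹ + y⁻¹ ^ 3) * y ^ 3 = y ^ 3 - y ^ 2 + 1 := by field_simp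
    rw [← e, h2, zero_mul]
  have h3 : y * (y - 1) = 0 := by linear_combination h1 - h2'
  rcases mul_eq_zero.mp h3 with h | h
  · exact hy h
  · rw [sub_eq_zero.mp h] at h1; norm_num at h1

/-- `P₀(y) = 1 - y² + y³` and `P₀(y⁻¹)` do not vanish simultaneously. -/
theorem smythP0_no_inverse_pair {y : ℂ} (hy : y ≠ 0) (h1 : 1 - y ^ 2 + y ^ 3 = 0)
    (h2 : 1 - y⁻¹ ^ 2 + y⁻¹ ^ 3 = 0) : False := by
  have h2' : y ^ 3 - y + 1 = 0 := by
    have e : (1 - y⁻¹ ^ 2 + y⁻¹ ^ 3) * y ^ 3 = y ^ 3 - y + 1 := by field_simp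
    rw [← e, h2, zero_mul]
  have h3 : y * (y - 1) = 0 := by linear_combination h2' - h1
  rcases mul_eq_zero.mp h3 with h | h
  · exact hy h
  · rw [sub_eq_zero.mp h] at h1; norm_num at h1

/-- Evaluation of `Q₀(aX^k)` over `ℂ`. -/
theorem eval_map_smythQ0a (a : ℤ) (k : ℕ) (z : ℂ) :
    ((1 - C a * X ^ k + C a * X ^ (3 * k) : ℤ[X]).map (Int.castRingHom ℂ)).eval z =
      1 - (a : ℂ) * z ^ k + (a : ℂ) * z ^ (3 * k) := by
  simp only [Polynomial.map_add, Polynomial.map_sub, Polynomial.map_one, Polynomial.map_mul,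
    Polynomial.map_pow, Polynomial.map_C, Polynomial.map_X]
  simp only [eval_add, eval_sub, eval_one, eval_mul, eval_pow, eval_C, eval_X, eq_intCast]

/-- Evaluation of `P₀(aX^k)` over `ℂ`. -/
theorem eval_map_smythP0a (a : ℤ) (k : ℕ) (z : ℂ) :
    ((1 - X ^ (2 * k) + C a * X ^ (3 * k) : ℤ[X]).map (Int.castRingHom ℂ)).eval z =
      1 - z ^ (2 * k) + (a : ℂ) * z ^ (3 * k) := by
  simp only [Polynomial.map_add, Polynomial.map_sub, Polynomial.map_one, Polynomial.map_mul,
    Polynomial.map_pow, Polynomial.map_C, Polynomial.map_X]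
  simp only [eval_add, eval_sub, eval_one, eval_mul, eval_pow, eval_C, eval_X, eq_intCast]

/-- `Q₀(aX^k)` has no root pair `β, β⁻¹` (`a = ±1`). -/
theorem smythQ0a_no_inverse_pair {a : ℤ} (ha : a = 1 ∨ a = -1) (k : ℕ) {β : ℂ} (hβ : β ≠ 0)
    (h1 : ((1 - C a * X ^ k + C a * X ^ (3 * k) : ℤ[X]).map (Int.castRingHom ℂ)).eval β = 0)
    (h2 : ((1 - C a * X ^ k + C a * X ^ (3 * k) : ℤ[X]).map (Int.castRingHom ℂ)).eval β⁻¹ = 0) :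
    False := by
  have haC : (a : ℂ) * a = 1 := by rcases ha with h | h <;> simp [h]
  have hainv : ((a : ℂ))⁻¹ = a := inv_eq_of_mul_eq_one_right haC
  have ha0 : (a : ℂ) ≠ 0 := by intro h; rw [h, zero_mul] at haC; exact zero_ne_one haC
  rw [eval_map_smythQ0a] at h1 h2
  have hy0 : (a : ℂ) * β ^ k ≠ 0 := mul_ne_zero ha0 (pow_ne_zero _ hβ)
  refine smythQ0_no_inverse_pair hy0 ?_ ?_
  · linear_combination h1 + ((a : ℂ) * β ^ (3 * k)) * haC
  · rw [mul_inv, hainv, ← inv_pow]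
    linear_combination h2 + ((a : ℂ) * β⁻¹ ^ (3 * k)) * haC

/-- `P₀(aX^k)` has no root pair `β, β⁻¹` (`a = ±1`). -/
theorem smythP0a_no_inverse_pair {a : ℤ} (ha : a = 1 ∨ a = -1) (k : ℕ) {β : ℂ} (hβ : β ≠ 0)
    (h1 : ((1 - X ^ (2 * k) + C a * X ^ (3 * k) : ℤ[X]).map (Int.castRingHom ℂ)).eval β = 0)
    (h2 : ((1 - X ^ (2 * k) + C a * X ^ (3 * k) : ℤ[X]).map (Int.castRingHom ℂ)).eval β⁻¹ = 0) :
    False := by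
  have haC : (a : ℂ) * a = 1 := by rcases ha with h | h <;> simp [h]
  have hainv : ((a : ℂ))⁻¹ = a := inv_eq_of_mul_eq_one_right haC
  have ha0 : (a : ℂ) ≠ 0 := by intro h; rw [h, zero_mul] at haC; exact zero_ne_one haC
  rw [eval_map_smythP0a] at h1 h2
  have hy0 : (a : ℂ) * β ^ k ≠ 0 := mul_ne_zero ha0 (pow_ne_zero _ hβ)
  refine smythP0_no_inverse_pair hy0 ?_ ?_
  · linear_combination h1 + (-(β ^ (2 * k)) + (a : ℂ) * β ^ (3 * k)) * haC
  · rw [mul_inv, hainv, ← inv_pow]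
    linear_combination h2 + (-(β⁻¹ ^ (2 * k)) + (a : ℂ) * β⁻¹ ^ (3 * k)) * haC

/-! ### Reciprocal factors are constant -/

/-- If `A ∣ T` in `ℤ[X]` with `T(0) = 1`, `A` is reciprocal or antireciprocal, and `T` has no complex root
pair `β, β⁻¹`, then `A` is constant. -/
theorem natDegree_eq_zero_of_reciprocal_dvd {A T : ℤ[X]} (hT0 : T.coeff 0 = 1)
    (hT : ∀ β : ℂ, β ≠ 0 → (T.map (Int.castRingHom ℂ)).eval β = 0 →
      (T.map (Int.castRingHom ℂ)).eval β⁻¹ = 0 → False)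
    (hdvd : A ∣ T) (hrec : A.reverse = A ∨ A.reverse = -A) : A.natDegree = 0 := by
  obtain ⟨q, hq⟩ := hdvd
  have hA0 : A.coeff 0 ≠ 0 := by
    intro h
    have := congrArg (fun p : ℤ[X] => p.coeff 0) hq
    simp only [mul_coeff_zero, h, zero_mul, hT0] at this
    exact one_ne_zero this
  by_contra hne
  have hdeg : 0 < (A.map (Int.castRingHom ℂ)).degree := by
    rw [degree_map_eq_of_injective (RingHom.injective_int (Int.castRingHom ℂ))]
    exact natDegree_pos_iff_degree_pos.mp (Nat.pos_of_ne_zero hne)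
  obtain ⟨β, hβ⟩ := Complex.exists_root hdeg
  rw [IsRoot.def] at hβ
  have hβ0 : β ≠ 0 := by
    rintro rfl
    rw [← coeff_zero_eq_eval_zero, coeff_map, eq_intCast] at hβ
    exact hA0 (by exact_mod_cast hβ)
  -- `A(β⁻¹) = 0` by (anti)reciprocity
  have hβ' : (A.map (Int.castRingHom ℂ)).eval β⁻¹ = 0 := by
    letI : Invertible β := invertibleOfNonzero hβ0
    have h := (eval₂_reverse_eq_zero_iff (Int.castRingHom ℂ) β A).mpr (by rwa [eval_map] at hβ)
    rw [invOf_eq_inv] at h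
    rw [eval_map]
    rcases hrec with hr | hr
    · rwa [hr] at h
    · rw [hr, eval₂_neg, neg_eq_zero] at h; exact h
  -- `T(β) = T(β⁻¹) = 0`
  have hT1 : (T.map (Int.castRingHom ℂ)).eval β = 0 := by
    rw [hq, Polynomial.map_mul, eval_mul, hβ, zero_mul]
  have hT2 : (T.map (Int.castRingHom ℂ)).eval β⁻¹ = 0 := by
    rw [hq, Polynomial.map_mul, eval_mul, hβ', zero_mul]
  exact hT β hβ0 hT1 hT2

/-! ### Irreducibility -/

/-- **Irreducibility via Smyth's inequality.**  Let `T ∈ ℤ[X]` with `T(0) = 1`, `deg T ≥ 1`,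
`M(T) = θ₀`, and no complex root pair `β, β⁻¹`.  Then `T` is irreducible: every nonconstant factor is
nonreciprocal (by `natDegree_eq_zero_of_reciprocal_dvd`) hence has measure `≥ θ₀`, and `θ₀ < θ₀²`. -/
theorem irreducible_of_smyth_trinomial {T : ℤ[X]} (hT0 : T.coeff 0 = 1) (hTdeg : 0 < T.natDegree)
    (hMT : intMahlerMeasure T = smythTheta)
    (hT : ∀ β : ℂ, β ≠ 0 → (T.map (Int.castRingHom ℂ)).eval β = 0 →
      (T.map (Int.castRingHom ℂ)).eval β⁻¹ = 0 → False) : Irreducible T := by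
  refine irreducible_iff.mpr ⟨fun hu => ?_, fun A B hAB => ?_⟩
  · have := natDegree_eq_zero_of_isUnit hu
    omega
  -- constant coefficients `A(0) B(0) = 1`
  have hc : A.coeff 0 * B.coeff 0 = 1 := by rw [← mul_coeff_zero, ← hAB, hT0]
  have hA0 : A.coeff 0 = 1 ∨ A.coeff 0 = -1 := Int.eq_one_or_neg_one_of_mul_eq_one hc
  have hB0 : B.coeff 0 = 1 ∨ B.coeff 0 = -1 := Int.eq_one_or_neg_one_of_mul_eq_one (by rw [mul_comm]; exact hc)
  have unit_of_const : ∀ {D : ℤ[X]}, (D.coeff 0 = 1 ∨ D.coeff 0 = -1) → D.natDegree = 0 → IsUnit D := by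
    intro D hD0 hD
    rw [eq_C_of_natDegree_eq_zero hD, isUnit_C]
    rcases hD0 with h | h
    · rw [h]; exact isUnit_one
    · rw [h]; exact isUnit_one.neg
  by_cases hA : A.natDegree = 0
  · exact Or.inl (unit_of_const hA0 hA)
  by_cases hB : B.natDegree = 0
  · exact Or.inr (unit_of_const hB0 hB)
  exfalso
  -- both factors are nonconstant, hence nonreciprocal, hence of measure `≥ θ₀`
  have hAdvd : A ∣ T := ⟨B, hAB⟩
  have hBdvd : B ∣ T := ⟨A, by rw [hAB, mul_comm]⟩
  have hA1 : A.reverse ≠ A := fun h => hA (natDegree_eq_zero_of_reciprocal_dvd hT0 hT hAdvd (Or.inl h))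
  have hA2 : A.reverse ≠ -A := fun h => hA (natDegree_eq_zero_of_reciprocal_dvd hT0 hT hAdvd (Or.inr h))
  have hB1 : B.reverse ≠ B := fun h => hB (natDegree_eq_zero_of_reciprocal_dvd hT0 hT hBdvd (Or.inl h))
  have hB2 : B.reverse ≠ -B := fun h => hB (natDegree_eq_zero_of_reciprocal_dvd hT0 hT hBdvd (Or.inr h))
  have hA0' : A.coeff 0 ≠ 0 := by rcases hA0 with h | h <;> rw [h] <;> norm_num
  have hB0' : B.coeff 0 ≠ 0 := by rcases hB0 with h | h <;> rw [h] <;> norm_num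
  have hMA := intMahlerMeasure_ge_smythTheta_of_nonreciprocal hA0' hA1 hA2
  have hMB := intMahlerMeasure_ge_smythTheta_of_nonreciprocal hB0' hB1 hB2
  have hprod : intMahlerMeasure T = intMahlerMeasure A * intMahlerMeasure B := by
    rw [hAB, intMahlerMeasure_mul]
  have hθ := smythTheta_gt
  have : smythTheta * smythTheta ≤ smythTheta := by
    calc smythTheta * smythTheta ≤ intMahlerMeasure A * intMahlerMeasure B :=
          mul_le_mul hMA hMB (by linarith) (le_trans (by linarith) hMA)
      _ = smythTheta := by rw [← hprod, hMT]
  nlinarith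

/-- **`Q₀(aX^k) = 1 - aX^k + aX^{3k}` is irreducible over `ℤ`** (`a = ±1`, `k ≥ 1`); in particular
`z^{3k} - z^k - 1 = -Q₀(-z^k)` and `z^{3k} - z^k + 1 = Q₀(z^k)` are irreducible. -/
theorem irreducible_smythQ0a {a : ℤ} (ha : a = 1 ∨ a = -1) {k : ℕ} (hk : 1 ≤ k) :
    Irreducible (1 - C a * X ^ k + C a * X ^ (3 * k) : ℤ[X]) := by
  have ha0 : a ≠ 0 := by rcases ha with h | h <;> simp [h]
  refine irreducible_of_smyth_trinomial ?_ ?_ (intMahlerMeasure_smythQ0a ha hk)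
    (fun β hβ h1 h2 => smythQ0a_no_inverse_pair ha k hβ h1 h2)
  · simp only [coeff_add, coeff_sub, coeff_one_zero, coeff_C_mul_X_pow]
    rw [if_neg (by omega), if_neg (by omega)]; norm_num
  · refine lt_of_lt_of_le (by omega : 0 < 3 * k) (le_natDegree_of_ne_zero ?_)
    simp only [coeff_add, coeff_sub, coeff_one, coeff_C_mul_X_pow]
    rw [if_neg (by omega), if_neg (by omega)]; simpa using ha0

/-- **`P₀(aX^k) = 1 - X^{2k} + aX^{3k}` is irreducible over `ℤ`** (`a = ±1`, `k ≥ 1`); in particular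
`z^{3k} + z^{2k} - 1 = -P₀(-z^k)` and `z^{3k} - z^{2k} + 1 = P₀(z^k)` are irreducible. -/
theorem irreducible_smythP0a {a : ℤ} (ha : a = 1 ∨ a = -1) {k : ℕ} (hk : 1 ≤ k) :
    Irreducible (1 - X ^ (2 * k) + C a * X ^ (3 * k) : ℤ[X]) := by
  have ha0 : a ≠ 0 := by rcases ha with h | h <;> simp [h]
  refine irreducible_of_smyth_trinomial ?_ ?_ (intMahlerMeasure_smythP0a ha hk)
    (fun β hβ h1 h2 => smythP0a_no_inverse_pair ha k hβ h1 h2)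
  · simp only [coeff_add, coeff_sub, coeff_one_zero, coeff_X_pow, coeff_C_mul_X_pow]
    rw [if_neg (by omega), if_neg (by omega)]; norm_num
  · refine lt_of_lt_of_le (by omega : 0 < 3 * k) (le_natDegree_of_ne_zero ?_)
    simp only [coeff_add, coeff_sub, coeff_one, coeff_X_pow, coeff_C_mul_X_pow]
    rw [if_neg (by omega), if_neg (by omega)]; simpa using ha0

/-! ### The equality case, verbatim -/

/-- **Smyth's theorem, the equality case as printed** ([McKee–Smyth, Thm 12.1]).  For an irreducible
`P ∈ ℤ[X]` with `P(0) ≠ 0` which is neither reciprocal nor antireciprocal, `M(P) = θ₀` if and only if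
`P = ± P₀(aX^k) = ±(1 - X^{2k} + aX^{3k})` or `P = ± Q₀(aX^k) = ±(1 - aX^k + aX^{3k})` for some `k ≥ 1`,
`a = ±1` — i.e. `P` is one of `±(z^{3k} - z^k - 1)`, `±(z^{3k} + z^{2k} - 1)` or their `z ↦ -z`
companions `±(z^{3k} - z^k + 1)`, `±(z^{3k} - z^{2k} + 1)`. -/
theorem intMahlerMeasure_eq_smythTheta_iff_eq {P : ℤ[X]} (hirr : Irreducible P) (h0 : P.coeff 0 ≠ 0)
    (h1 : P.reverse ≠ P) (h2 : P.reverse ≠ -P) :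
    intMahlerMeasure P = smythTheta ↔ ∃ k : ℕ, 1 ≤ k ∧ ∃ a : ℤ, (a = 1 ∨ a = -1) ∧ ∃ s : ℤ, (s = 1 ∨ s = -1) ∧
      (P = C s * (1 - X ^ (2 * k) + C a * X ^ (3 * k)) ∨ P = C s * (1 - C a * X ^ k + C a * X ^ (3 * k))) := by
  rw [intMahlerMeasure_eq_smythTheta_iff_dvd hirr h0 h1 h2]
  -- an irreducible divisor of an irreducible polynomial is `±` it
  have key : ∀ {T : ℤ[X]}, Irreducible T → P ∣ T → ∃ s : ℤ, (s = 1 ∨ s = -1) ∧ P = C s * T := by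
    intro T hT hPT
    obtain ⟨q, hq⟩ := hPT
    rcases hT.isUnit_or_isUnit hq with hu | hu
    · exact absurd hu hirr.not_isUnit
    · obtain ⟨r, hr, hrq⟩ := Polynomial.isUnit_iff.mp hu
      rcases Int.isUnit_iff.mp hr with h | h
      · refine ⟨1, Or.inl rfl, ?_⟩
        rw [hq, ← hrq, h, map_one, mul_one, one_mul]
      · refine ⟨-1, Or.inr rfl, ?_⟩
        rw [hq, ← hrq, h, map_neg, map_one]; ring
  constructor
  · rintro ⟨k, hk, a, ha, hdvd⟩
    refine ⟨k, hk, a, ha, ?_⟩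
    rcases hdvd with h | h
    · obtain ⟨s, hs, hP⟩ := key (irreducible_smythP0a ha hk) h
      exact ⟨s, hs, Or.inl hP⟩
    · obtain ⟨s, hs, hP⟩ := key (irreducible_smythQ0a ha hk) h
      exact ⟨s, hs, Or.inr hP⟩
  · rintro ⟨k, hk, a, ha, s, hs, hP⟩
    refine ⟨k, hk, a, ha, ?_⟩
    have hsdvd : ∀ {T : ℤ[X]}, P = C s * T → P ∣ T := by
      intro T hPT
      refine ⟨C s, ?_⟩
      rw [hPT, mul_comm (C s) T, mul_assoc, ← map_mul]
      rcases hs with h | h <;> simp [h]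
    rcases hP with h | h
    · exact Or.inl (hsdvd h)
    · exact Or.inr (hsdvd h)

end Summit.Ventures.DiscreteObjects.Mahler
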